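import Literature.MathematicalPhysics.QuantumFieldTheory.Balaban1983to89.B13TermDatum214CouplingHolo

/-!
# BalabanUVNodes ∕ N10 ([B13], NODE A) → N22 (NE9): THE PER-TERM COMPLEX-LAST-COUPLING ROWS `hTh` ∧ `hT226` OF THE N22 ROAD-2 BILL FROM LOCATED (2.26) RECORDS
# AND def-W1's COUPLING DICTIONARY (module 111; plug for J79 ∕ module 109B)

Track A of `YM-PLAN.md` (cell `pub-ymgap`, D-0062), seat `pub-ymgap-dag-n10-c` g20, DAG edge **N10 → N22**.  THEOREMS ONLY (0 `def`, 0 `sorry`, standard axioms);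
`--supports stmt-QuantumFields-27364 --as helper`; COUNT-NEUTRAL.  After module 109B (`lastCouplingSectors_termData_of_termSectors`) and the N22 junction of record J79
(`…TermDataTableGermsLocatedRadiiTermSectors`, dag-n22-c g19) the last-coupling side of N22's ROAD-2 bill at def-W1's term data `(𝔇 K).Gn` is PER TERM: `hTh` (holomorphy
of `z ↦ (𝔇 K k).TF Z s z old φ` on the open `O K`), `hT226` ((2.26) there), and the centred pair `hT₀`∕`hTq`.  THIS FILE discharges the FIRST TWO by name from, per slice
and term, ONE located (2.26) record at some base coupling `s₀` and the history `old` of the slice + def-W1's COUPLING DICTIONARY on `O K` — the characteristic functions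
do not move (`chiY₀ Z s z = chiY₀ Z s s₀`, `chicP Z s z = chicP Z s s₀`), Lemma 2's potentials `z ↦ (𝔇 K k).𝒱 Z s z old φ Y B` are complex differentiable, measurable and
obey (2.20) with the record's letters on the record's τ-region uniformly on `O K` — via `B13TermDatum214CouplingHolo.termCouplingSector_of_inputs226Holo` (module 110).
★★★ `termCouplingSectors_of_inputs226Holo_dictionary` states the two families in J79's binder shapes (`Adm`, `spX` generic: the consumer's
`old ∈ AdmHist (sp K) E₀ r₁ k ∧ old 0 = 0` and `sp K (k+1)`).
HONEST FRAMING (binding).  Kernel composition (module 110 per term); the located records and the dictionary rows are DISPLAYED HYPOTHESES about def-W1's datum — in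
particular «the characteristic functions do not depend on the complex coupling on the sector» is a READING of print's (2.3) (thresholds of the real step), not a
theorem here; the centred pair `hT₀`∕`hTq` is NOT produced; NO estimate of Bałaban's is proved; N10 ∕ N22 NOT discharged (28∕28 · 7∕27 UNCHANGED); K1⁹ ∕ K3⁸ NOT
closed; one finite 𝕋⁴ programme at fixed ε — nothing continuum ∕ ℝ⁴ ∕ OS ∕ mass-gap ∕ Clay.  References (TYPES only): [II] CMP 116 (1988) (2.3) p. 12, (2.14) p. 15,
(2.20) p. 16, (2.26) p. 17; [I] CMP 109 (1987) p. 263.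

A6 NOTE (v1.0.1, 2026-08-29, after dag-n22-c g20's LOCATED finding and its certificate `…N22TermDataCouplingDictionaryRigidity.lean` (p686440 ✓ bb5255ca9440:
`chiU_couplingBlind_of_couplingDictionary`, `false_of_frozenChi_law_of_genuineBox`)).  This theorem is TRUE but is NOT a plug of record for J79's `hTh hT226`: jointly with the
bill's own law `hlaw : (𝔇 K).UnscaledFieldLawOn …` and sector clause `hballS : closedBall ↑t (c_S·t) ⊆ O K` the dictionary `hιO` (characteristic functions frozen on `O K`)
forces `χᵘ K k Z s (t • B) = χᵘ K k Z s (t′ • B)` for all window couplings `t, t′` — COUPLING-BLIND unscaled boxes, degenerate for genuine boxes ([I] p. 267 «B = g_kB′»).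
The binders of record for the last-coupling side are the MEMBER-level letters `hMdiff hMbd hT₀ hMcen` of def-W1's window-dilated members `TermData214.memberTF … t` on
`ball 1 ρ_b` at every base point `t ∈ ]0,γ]` (dag-n22-c g20 J86 ∕ J81m), produced from located primitives by the N22 lane's `…N22W1RelCentredMembersOfDatum*` over this
lane's `B13Term214WindowDilated` ∕ `B13Bound226Centred` engines; module 109B §2 (generic in the term family) serves the continued terms verbatim.
-/

noncomputable section

open Set Metric
open scoped BigOperators Matrix

namespace YMDAG.N10

open Literature.MathematicalPhysics.QuantumFieldTheory.Balaban1983to89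
open Literature.MathematicalPhysics.QuantumFieldTheory.Balaban1983to89.T4Continuum (T4Family)
open Literature.MathematicalPhysics.QuantumFieldTheory.Balaban1983to89.TreeLengthTorus (TDom)
open Literature.MathematicalPhysics.QuantumFieldTheory.Balaban1983to89.B13Lemma3TorusTerms (terms weight)
open Literature.MathematicalPhysics.QuantumFieldTheory.Balaban1983to89.Node00
open Literature.MathematicalPhysics.QuantumFieldTheory.Balaban1983to89.Node00.Sect2 (domSys domCount CPair)
open Literature.MathematicalPhysics.QuantumFieldTheory.Balaban1983to89.Node00.W1
open Literature.MathematicalPhysics.QuantumFieldTheory.Balaban1983to89.B13TermDatum214CouplingHolo (termCouplingSector_of_inputs226Holo)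

variable (F : T4Family) {M : ℕ} [NeZero M] (L : ℕ) [NeZero L] {𝔸 : Type} {c₀ : B13.Consts} (𝔇 : (K : ℕ) → TermData214 c₀ (F.P K) 𝔸 M L)
  (spX : (K k : ℕ) → (domSys (F.P K) M (k + 1)).Dom → Set (CPair (F.P K) 𝔸)) (Adm : (K k : ℕ) → OlderTerms (F.P K) 𝔸 M k → Prop)
  (O : ℕ → Set ℂ)

open Classical in
/-- ★★★ **THE PER-TERM COUPLING ROWS `hTh` ∧ `hT226` OF J79 ∕ MODULE 109B FROM LOCATED RECORDS + def-W1's COUPLING DICTIONARY.**  Per slice `(K, k, old ∈ Adm K k, X,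
φ ∈ spX K k X)`, polymer `Z ⊂ X` and label `s ∈ terms L M Z`: a base coupling `s₀`, ONE record `ι : (𝔇 K k).Inputs226Holo c Z s s₀ old φ a a₅`, and on the open `O K`
the dictionary rows — characteristic functions fixed (`chiY₀ Z s z = chiY₀ Z s s₀`, `chicP Z s z = chicP Z s s₀`), potentials `z ↦ 𝒱 Z s z old φ Y B` complex
differentiable on `O K`, measurable, and (2.20) with `ι`'s letters on `Π ι.Uτ` for every `z ∈ O K` — plus `1 ≤ c.κ₁`, `c.α₆ ≠ 0` ⟹
**(hTh)** `DifferentiableOn ℂ (z ↦ (𝔇 K k).TF Z s z old φ) (O K)` and **(hT226)** `‖(𝔇 K k).TF Z s z old φ‖ ≤ weight L M c Z a s·e^{a₅|Z|}` on `O K`. [folklore] -/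
theorem termCouplingSectors_of_inputs226Holo_dictionary {c : B13.Consts} (hκ₁ : 1 ≤ c.κ₁) (hα₆ : c.α₆ ≠ 0) {a a₅ : ℝ} (hO : ∀ K, IsOpen (O K))
    (hιO : ∀ (K k : ℕ) (old : OlderTerms (F.P K) 𝔸 M k), Adm K k old → ∀ (X : (domSys (F.P K) M (k + 1)).Dom), ∀ φ ∈ spX K k X,
      ∀ Z : (domSys (F.P K) M (k + 1)).Dom, Subtype.val Z ⊆ Subtype.val X → ∀ s ∈ terms L M Z,
        ∃ s₀ : ℂ, ∃ ι : (𝔇 K k).Inputs226Holo c Z s s₀ old φ a a₅,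
          (∀ z ∈ O K, (𝔇 K k).chiY₀ Z s z = (𝔇 K k).chiY₀ Z s s₀ ∧ (𝔇 K k).chicP Z s z = (𝔇 K k).chicP Z s s₀) ∧
          (∀ z ∈ O K, ∀ Y, Measurable ((𝔇 K k).𝒱 Z s z old φ Y)) ∧
          (∀ Y B, DifferentiableOn ℂ (fun z => (𝔇 K k).𝒱 Z s z old φ Y B) (O K)) ∧
          (∀ z ∈ O K, ∀ τ : TDom (F.P K).d (L * domCount (F.P K) M (k + 1)) → ℂ, (∀ Y, τ Y ∈ ι.Uτ Y) →
            ∀ B : ((𝔇 K k).𝒦 Z s).Λ → ℝ, ∑ Y ∈ s.1, ‖τ Y‖ * ‖(𝔇 K k).𝒱 Z s z old φ Y B‖ ≤ ι.a₂₀ / 2 * (B ⬝ᵥ B) + ι.w)) :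
    (∀ (K k : ℕ) (old : OlderTerms (F.P K) 𝔸 M k), Adm K k old → ∀ (X : (domSys (F.P K) M (k + 1)).Dom), ∀ φ ∈ spX K k X,
      ∀ Z : (domSys (F.P K) M (k + 1)).Dom, Subtype.val Z ⊆ Subtype.val X → ∀ s ∈ terms L M Z,
        DifferentiableOn ℂ (fun z => (𝔇 K k).TF Z s z old φ) (O K)) ∧
    (∀ (K k : ℕ) (old : OlderTerms (F.P K) 𝔸 M k), Adm K k old → ∀ (X : (domSys (F.P K) M (k + 1)).Dom), ∀ φ ∈ spX K k X,
      ∀ Z : (domSys (F.P K) M (k + 1)).Dom, Subtype.val Z ⊆ Subtype.val X → ∀ s ∈ terms L M Z, ∀ z ∈ O K,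
        ‖(𝔇 K k).TF Z s z old φ‖ ≤ weight L M c Z a s * Real.exp (a₅ * ((Z.1).card : ℝ))) := by
  refine ⟨fun K k old hold X φ hφ Z hZ s hs => ?_, fun K k old hold X φ hφ Z hZ s hs => ?_⟩
  · obtain ⟨s₀, ι, hχ, hVm, hVd, h220O⟩ := hιO K k old hold X φ hφ Z hZ s hs
    exact (termCouplingSector_of_inputs226Holo (𝔇 K k) hκ₁ hα₆ ι (hO K) hχ hVm hVd h220O).1
  · obtain ⟨s₀, ι, hχ, hVm, hVd, h220O⟩ := hιO K k old hold X φ hφ Z hZ s hs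
    exact (termCouplingSector_of_inputs226Holo (𝔇 K k) hκ₁ hα₆ ι (hO K) hχ hVm hVd h220O).2

end YMDAG.N10

end
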